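import Literature.NumberTheory.EllipticCurves.KatoTwistedFiniteness
import Literature.NumberTheory.EllipticCurves.PAdicBSD
import Literature.NumberTheory.EllipticCurves.AnalyticRankModularityProofs
import Literature.NumberTheory.EllipticCurves.ModularityVersionAp
import HarnessLib

/-!
# Kato's Cor. 14.3 (2) over `ℚ(ζ_m)` at the trivial character, and the `K = ℚ` fact bsd.S20

Topic `Literature/NumberTheory/EllipticCurves`; theorems only (no definition, no named fact).

K. Kato, *`p`-adic Hodge theory and values of zeta functions of modular forms*, Astérisque 295
(2004), Cor. 14.3 (2) (p. 235) appears in the tree in three spellings: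

* `kato_finite_chiPart_of_twistedLValue_ne_zero` (`KatoTwistedFiniteness`, named fact; `E/ℚ`
  elliptic with newform `f`, `K = ℚ(ζ_m)`, `m ≢ 2 (mod 4)`, `χ` a Dirichlet character mod `m`:
  `L_{prime(m)}(f, χ, 1) ≠ 0 ⇒ E(K)^(χ)` finite);
* its all-moduli form (every `m ≥ 1`, any decidability instance on `K`): the statement of
  `kato_finite_chiPart_cyclotomic_of_twistedLValue_ne_zero_of` (`KatoTwistedFinitenessProofs`),
  proved there equivalent to the named fact (`kato_finite_chiPart_cyclotomic_iff`);
* `kato_finite_of_L_one_ne_zero` (`PAdicBSD`, bsd.S20, named fact; `K = ℚ`, `χ = 1`: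
  `L(E, 1) ≠ 0 ⇒ E(ℚ)`, `Ш(E/ℚ)[p^∞]`, `Sel_{p^∞}(E/ℚ)` finite).

This file proves the two elementary implications between the cyclotomic spellings AT THE TRIVIAL
CHARACTER and the `K = ℚ` spelling, i.e. it makes rigorous the remark of the module docstring of
`KatoTwistedFiniteness` ("The trivial-character case over `ℚ` (`m = 1`) is the tree's
`kato_finite_of_L_one_ne_zero`"):

1. `mem_chiPart_iff_of_eq_intCast`, `mem_chiPart_of_forall_eq_one_iff` — for an integer-valued
   character Kato's `χ`-part `M^(χ) = {x ; I_χ x = 0}` is the eigenspace `{x ; g x = χ(g) x}`; for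
   the trivial character (`I_1` the augmentation ideal) it is the group of common fixed points
   `M^G` (Kato, p. 235, definition of `M^(χ)`).
2. `exists_baseChange_eq_of_forall_map_eq` — Galois descent for points: a point of `E(K)` fixed
   by `Aut(K/F)`, `K/F` finite Galois, comes from `E(F)` (coordinates lie in `K^{Gal} = F`); hence
   `E(K)^(1) = ι(E(F)) ≅ E(F)` (`finite_chiPart_one_iff`).
3. `LSeries_indicator_not_dvd_eq`, `LSeries_indicator_coprime_eq` — **removing Euler factors**
   (Kato §6.2, p. 161: `L_S(f, χ, s) = ∑_{(n,S)=1} aₙ χ(n) n⁻ˢ`; Shimura 1971, Thm. 3.66): for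
   Dirichlet coefficients satisfying Hecke's relation `a_{pn} = a_p aₙ − e_p 𝟙_{p∣n} a_{n/p}` at the
   primes `p ∈ S`, `∑_{(n,S)=1} aₙ n⁻ˢ = ∏_{p ∈ S} (1 − a_p p⁻ˢ + e_p p⁻²ˢ) · ∑ aₙ n⁻ˢ` on the
   domain of absolute convergence; for a newform `f ∈ S₂(Γ₀(N))` and the trivial character mod
   `m` this reads `L_{prime(m)}(f, 𝟙, s) = ∏_{p ∣ m} (1 − a_p p⁻ˢ + 𝟙_N(p) p · p⁻²ˢ) L(f, s)`
   (`twistedLSeries_one_eq`), `re s > 2`.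
4. `entireLFunction_one_ne_zero_of_twistedLSeries_one` — by the identity theorem the entire
   continuation of `L_{prime(m)}(f, 𝟙, s)` is `∏_{p ∣ m}(…) · L(E, s)` (`W.entireLFunction`, entire
   by Hecke since `aₙ(f) = aₙ(E)`), so `L_{prime(m)}(f, 𝟙, 1) ≠ 0 ⇒ L(E, 1) ≠ 0`. (This is the
   step "`L(f, χ, s)` means `L_S(f, χ, s)`", Kato p. 235, for `χ = 1`: the finitely many missing
   Euler factors are entire.) Conversely for `m = 1` nothing is removed
   (`twistedLSeries_one_eq_cuspFormLSeries_of_one`).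
5. Assembly: `kato_finite_chiPart_cyclotomic_one_of_kato_finite_of_L_one_ne_zero` — bsd.S20 (for
   every elliptic `W/ℚ`, at any one prime) implies the trivial-character case of the
   all-moduli form, for every `m ≥ 1`; and
   `finite_point_of_kato_finite_chiPart` — conversely the vendored fact
   `kato_finite_chiPart_of_twistedLValue_ne_zero` at `m = 1` gives the Mordell–Weil clause of
   bsd.S20: `L(E, 1) ≠ 0 ⇒ E(ℚ)` finite, for every elliptic `E/ℚ` with a newform.

Nothing here touches Kato's Euler-system argument (Thm. 14.2 (2) proper); the file only pins down
how the three statements overlap.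

## References

* K. Kato, *`p`-adic Hodge theory and values of zeta functions of modular forms*, Astérisque 295
  (2004), 117–290: §6.2 (p. 161), Thm. 14.2 and Cor. 14.3 (p. 235). [Kato2004Asterisque]
* G. Shimura, *Introduction to the Arithmetic Theory of Automorphic Functions* (1971), Thm. 3.66.
  [Shimura1971]
* F. Diamond, J. Shurman, *A First Course in Modular Forms*, GTM 228 (2005), Prop. 5.8.5,
  Thm. 5.9.2. [DiamondShurman2005]
-/

noncomputable section

open scoped BigOperators

open WeierstrassCurve WeierstrassCurve.Affine CongruenceSubgroup Complex

namespace Literature.NumberTheory.EllipticCurves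

/-! ## 1. The `χ`-part at the trivial character -/

section TrivialCharacter

variable {G M R : Type*} [AddCommGroup M] [CommRing R]

/-- **The `χ`-part of an integer-valued character is the `χ`-eigenspace.** If `χ = c` takes values
in (the image of) `ℤ`, with `c 1 = 1`, and `ρ 1 = id`, then `x ∈ M^(χ)` iff `ρ g x = c(g) · x` for
all `g`: indeed `g − c(g) · 1 ∈ I_χ`, and conversely `I_χ = {∑ n_g g ; ∑ n_g c(g) = 0}` kills every
such `x` (`R` of characteristic zero). This covers the trivial character (`c = 1`,
`mem_chiPart_of_forall_eq_one_iff`) and the quadratic ones (`c = ±1`). (Kato, Astérisque 295,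
p. 235, definition of `M^(χ)`.) [cite: Kato2004Asterisque, §14 Thm. 14.2 (p. 235)] -/
theorem mem_chiPart_iff_of_eq_intCast [CharZero R] [One G] {ρ : G → M →+ M}
    (hρ : ∀ x, ρ 1 x = x) {χ : G → R} {c : G → ℤ} (hχ : ∀ g, χ g = c g) (hc : c 1 = 1) (x : M) :
    x ∈ chiPart ρ χ ↔ ∀ g, ρ g x = c g • x := by
  classical
  constructor
  · intro hx g
    have key := hx (Finsupp.single g 1 - Finsupp.single 1 (c g)) (by
      rw [Finsupp.sum_sub_index (fun _ _ _ => by push_cast; ring)]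
      simp [hχ, hc])
    rw [Finsupp.sum_sub_index (fun _ _ _ => sub_smul _ _ _)] at key
    simpa [hρ, sub_eq_zero] using key
  · intro hx a ha
    have hz : (∑ g ∈ a.support, a g * c g) = 0 := by
      have hsum : (((∑ g ∈ a.support, a g * c g : ℤ)) : R) = 0 := by
        rw [← ha, Finsupp.sum, Int.cast_sum]
        exact Finset.sum_congr rfl fun g _ => by rw [hχ, Int.cast_mul]
      exact_mod_cast hsum
    calc (a.sum fun g n => n • ρ g x) = ∑ g ∈ a.support, (a g * c g) • x := by
          simp only [Finsupp.sum, hx, smul_smul]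
      _ = (∑ g ∈ a.support, a g * c g) • x := (Finset.sum_smul).symm
      _ = 0 := by rw [hz, zero_smul]

/-- **`M^(1) = M^G`.** For the trivial character (`χ g = 1` for all `g`) and operators with
`ρ 1 = id`, Kato's `χ`-part `M^(χ) = {x ; I_χ x = 0}` is the subgroup of common fixed points of the
`ρ g`: `I_1` is the augmentation ideal, generated by the `g − 1` (`mem_chiPart_iff_of_eq_intCast`
with `c = 1`; `R` of characteristic zero). (Kato, Astérisque 295, p. 235.)
[cite: Kato2004Asterisque, §14 Thm. 14.2 (p. 235)] -/
theorem mem_chiPart_of_forall_eq_one_iff [CharZero R] [One G] {ρ : G → M →+ M}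
    (hρ : ∀ x, ρ 1 x = x) {χ : G → R} (hχ : ∀ g, χ g = 1) (x : M) :
    x ∈ chiPart ρ χ ↔ ∀ g, ρ g x = x := by
  rw [mem_chiPart_iff_of_eq_intCast hρ (c := fun _ => 1) (fun g => by rw [hχ, Int.cast_one]) rfl]
  simp only [one_smul]

end TrivialCharacter

/-! ## 2. Galois descent for points fixed by `Aut(K/F)` -/

section Descent

variable {F : Type*} [Field F] {K : Type*} [Field K] [Algebra F K] [DecidableEq F] [DecidableEq K]
  (V : WeierstrassCurve F)

/-- **Galois descent for rational points.** If `K/F` is finite Galois and `P ∈ V(K)` is fixed by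
`σ_* = Point.map σ` for every `σ ∈ Aut(K/F)`, then `P = ι(Q)` for a (unique) `Q ∈ V(F)`: the
coordinates of `P` lie in the fixed field `K^{Aut(K/F)} = F` (Mathlib
`IsGalois.mem_range_algebraMap_iff_fixed`). [folklore] -/
theorem exists_baseChange_eq_of_forall_map_eq [FiniteDimensional F K] [IsGalois F K]
    {P : (V.baseChange K).toAffine.Point}
    (hP : ∀ σ : K ≃ₐ[F] K, Point.map (W' := V.toAffine) (σ : K →ₐ[F] K) P = P) :
    ∃ Q : V.toAffine.Point, Point.baseChange (W' := V.toAffine) F K Q = P := by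
  rcases P with _ | ⟨x, y, h⟩
  · exact ⟨0, rfl⟩
  · have hxy : ∀ σ : K ≃ₐ[F] K, σ x = x ∧ σ y = y := fun σ => by
      have := hP σ
      rw [Point.map_some] at this
      exact Point.some.inj this
    obtain ⟨a, ha⟩ := (IsGalois.mem_range_algebraMap_iff_fixed x).mpr fun σ => (hxy σ).1
    obtain ⟨b, hb⟩ := (IsGalois.mem_range_algebraMap_iff_fixed y).mpr fun σ => (hxy σ).2
    subst ha hb
    exact ⟨.some a b ((WeierstrassCurve.Affine.baseChange_nonsingular (W := V)
      (f := Algebra.ofId F K) (algebraMap F K).injective a b).mp h), rfl⟩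

/-- The `χ`-part of `V(K)` at the trivial character of `Aut(K/F)` is the image of
`ι : V(F) → V(K)` when `K/F` is finite Galois (`mem_chiPart_of_forall_eq_one_iff`,
`exists_baseChange_eq_of_forall_map_eq`, and `σ_* ∘ ι = ι`). [folklore] -/
theorem mem_chiPart_one_iff [FiniteDimensional F K] [IsGalois F K] {R : Type*} [CommRing R]
    [CharZero R] {χ : (K ≃ₐ[F] K) → R} (hχ : ∀ σ, χ σ = 1) (P : (V.baseChange K).toAffine.Point) :
    P ∈ chiPart (fun σ : K ≃ₐ[F] K => Point.map (W' := V.toAffine) (σ : K →ₐ[F] K)) χ ↔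
      P ∈ Set.range (Point.baseChange (W' := V.toAffine) F K) := by
  rw [mem_chiPart_of_forall_eq_one_iff (fun Q => ?_) hχ]
  · constructor
    · exact fun h => exists_baseChange_eq_of_forall_map_eq V h
    · rintro ⟨Q, rfl⟩ σ
      exact Point.map_baseChange (W' := V.toAffine) (σ : K →ₐ[F] K) Q
  · rcases Q with _ | ⟨x, y, h⟩ <;> rfl

/-- **`V(K)^(1) ≅ V(F)`**, finiteness form: for `K/F` finite Galois and the trivial character of
`Aut(K/F)`, Kato's `χ`-part of `V(K)` is finite iff `V(F)` is (`ι` is injective with image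
`V(K)^(1)`). [folklore] -/
theorem finite_chiPart_one_iff [FiniteDimensional F K] [IsGalois F K] {R : Type*} [CommRing R]
    [CharZero R] {χ : (K ≃ₐ[F] K) → R} (hχ : ∀ σ, χ σ = 1) :
    Finite ↥(chiPart (fun σ : K ≃ₐ[F] K => Point.map (W' := V.toAffine) (σ : K →ₐ[F] K)) χ) ↔
      Finite V.toAffine.Point := by
  set C := chiPart (fun σ : K ≃ₐ[F] K => Point.map (W' := V.toAffine) (σ : K →ₐ[F] K)) χ
  have hmem : ∀ Q : V.toAffine.Point, Point.baseChange (W' := V.toAffine) F K Q ∈ C := fun Q =>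
    (mem_chiPart_one_iff V hχ _).mpr ⟨Q, rfl⟩
  constructor
  · intro hfin
    exact Finite.of_injective (fun Q => (⟨_, hmem Q⟩ : C)) fun Q Q' hQ =>
      Point.map_injective (W' := V.toAffine) _ (congrArg Subtype.val hQ)
  · intro hfin
    have hsurj : Function.Surjective fun Q : V.toAffine.Point => (⟨_, hmem Q⟩ : C) := by
      rintro ⟨P, hP⟩
      obtain ⟨Q, hQ⟩ := (mem_chiPart_one_iff V hχ P).mp hP
      exact ⟨Q, Subtype.ext hQ⟩
    exact Finite.of_surjective _ hsurj

end Descent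

/-! ## 3. Removing Euler factors from a Dirichlet series with Hecke's relation -/

section EulerFactors

open LSeries

/-- **Removing one Euler factor.** Let `a : ℕ → ℂ` satisfy Hecke's relation at `p ≥ 2`:
`a (p n) = a_p · a n − e · 𝟙_{p ∣ n} a (n / p)` (for a normalised eigenform, `a_p = a p` and
`e = χ(p) p^{k-1}`, Diamond–Shurman Prop. 5.8.5). Then wherever `∑ aₙ n⁻ˢ` converges absolutely,
`∑_{p ∤ n} aₙ n⁻ˢ = (1 − a_p p⁻ˢ + e p⁻²ˢ) · ∑ aₙ n⁻ˢ` — the Dirichlet series deprived of its Euler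
factor at `p` (Shimura 1971, Thm. 3.66; Kato, Astérisque 295, §6.2, p. 161). The proof splits the
sum over `p ∣ n` and `p ∤ n` and uses the relation on the multiples of `p` twice.
[cite: Shimura1971, Thm. 3.66] -/
theorem LSeries_indicator_not_dvd_eq {a : ℕ → ℂ} {p : ℕ} (hp : 1 < p) {ap e : ℂ}
    (hrel : ∀ n, a (p * n) = ap * a n - e * (if p ∣ n then a (n / p) else 0))
    {s : ℂ} (hsum : LSeriesSummable a s) :
    LSeries (fun n ↦ if p ∣ n then 0 else a n) s =
      (1 - ap * (p : ℂ) ^ (-s) + e * ((p : ℂ) ^ (-s)) ^ 2) * LSeries a s := by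
  have hp0 : p ≠ 0 := by omega
  have hpC : (p : ℂ) ≠ 0 := Nat.cast_ne_zero.mpr hp0
  have hps : (p : ℂ) ^ s ≠ 0 := by
    rw [Ne, cpow_eq_zero_iff, not_and_or]; exact Or.inl hpC
  have hinj : Function.Injective fun k : ℕ => p * k := mul_right_injective₀ hp0
  set t : ℂ := (p : ℂ) ^ (-s) with ht
  have htinv : t = ((p : ℂ) ^ s)⁻¹ := by rw [ht, cpow_neg]
  set F : ℕ → ℂ := term a s with hF
  set D : ℕ → ℂ := fun n ↦ if p ∣ n then 0 else F n with hD
  set M : ℕ → ℂ := fun n ↦ if p ∣ n then F n else 0 with hM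
  set H : ℕ → ℂ := fun n ↦ if p ∣ n then term (fun k ↦ a (k / p)) s n else 0 with hH
  have hS : Summable F := hsum
  -- the term function of the deprived series is `D`
  have htermD : term (fun n ↦ if p ∣ n then 0 else a n) s = D := by
    funext n
    by_cases hn : n = 0
    · subst hn; simp [hD, hF, term]
    · by_cases hpn : p ∣ n
      · simp [hD, term, hn, hpn]
      · simp [hD, hF, term, hn, hpn]
  -- summability of the pieces
  have hSD : Summable D := Summable.of_norm_bounded hS.norm fun n => by
    simp only [hD]; split_ifs <;> simp
  have hSM : Summable M := Summable.of_norm_bounded hS.norm fun n => by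
    simp only [hM]; split_ifs <;> simp
  have hFDM : ∀ n, F n = D n + M n := fun n => by
    simp only [hD, hM]; split_ifs <;> simp
  -- `∑ M = ∑_k F (p k)`
  have hsuppM : Function.support M ⊆ Set.range fun k : ℕ => p * k := by
    intro n hn
    simp only [Function.mem_support, hM] at hn
    by_cases hpn : p ∣ n
    · obtain ⟨k, rfl⟩ := hpn; exact ⟨k, rfl⟩
    · simp [hpn] at hn
  have hMsum : ∑' n, M n = ∑' k, F (p * k) := by
    rw [← hinj.tsum_eq hsuppM]
    exact tsum_congr fun k => by simp [hM]
  -- `∑ H = t ∑ F`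
  have hsuppH : Function.support H ⊆ Set.range fun k : ℕ => p * k := by
    intro n hn
    simp only [Function.mem_support, hH] at hn
    by_cases hpn : p ∣ n
    · obtain ⟨k, rfl⟩ := hpn; exact ⟨k, rfl⟩
    · simp [hpn] at hn
  have hpow : ∀ k : ℕ, (((p * k : ℕ) : ℂ)) ^ s = (p : ℂ) ^ s * (k : ℂ) ^ s := fun k => by
    rw [Nat.cast_mul]
    exact natCast_mul_natCast_cpow p k s
  have hHp : ∀ k, H (p * k) = t * F k := fun k => by
    rcases Nat.eq_zero_or_pos k with rfl | hk
    · simp [hH, hF, term]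
    · have hk0 : k ≠ 0 := hk.ne'
      have hpk0 : p * k ≠ 0 := mul_ne_zero hp0 hk0
      simp only [hH, hF, term, if_pos (dvd_mul_right p k), if_neg hpk0, if_neg hk0, hpow,
        Nat.mul_div_cancel_left k (Nat.pos_of_ne_zero hp0), htinv]
      field_simp
  have hSH : Summable H := by
    refine (hinj.summable_iff fun x hx => ?_).mp ?_
    · by_contra h
      exact hx (hsuppH h)
    simp only [Function.comp_def, hHp]
    exact hS.mul_left t
  have hHsum : ∑' n, H n = t * ∑' n, F n := by
    rw [← hinj.tsum_eq hsuppH]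
    simp only [hHp]
    exact tsum_mul_left
  -- the key pointwise identity on multiples of `p`
  have hkey : ∀ k, F (p * k) = t * ap * F k - t * e * H k := fun k => by
    rcases Nat.eq_zero_or_pos k with rfl | hk
    · simp [hF, hH, term]
    · have hk0 : k ≠ 0 := hk.ne'
      have hpk0 : p * k ≠ 0 := mul_ne_zero hp0 hk0
      have hks : (k : ℂ) ^ s ≠ 0 := by
        rw [Ne, cpow_eq_zero_iff, not_and_or]; exact Or.inl (Nat.cast_ne_zero.mpr hk0)
      have hHk : H k = (if p ∣ k then a (k / p) else 0) / (k : ℂ) ^ s := by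
        simp only [hH, term, if_neg hk0]
        split_ifs <;> simp
      simp only [hF, term, if_neg hpk0, if_neg hk0, hpow, hrel k, hHk, htinv]
      field_simp
  have hFp : Summable fun k => F (p * k) := hS.comp_injective hinj
  have hFpsum : ∑' k, F (p * k) = t * ap * (∑' n, F n) - t * e * (t * ∑' n, F n) := by
    rw [← hHsum, ← tsum_mul_left, ← tsum_mul_left, ← (hS.mul_left _).tsum_sub (hSH.mul_left _)]
    exact tsum_congr hkey
  -- assemble
  have hLD : LSeries (fun n ↦ if p ∣ n then 0 else a n) s = ∑' n, D n := by
    rw [LSeries, htermD]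
  have hA : LSeries a s = ∑' n, F n := rfl
  have hsplit : ∑' n, F n = ∑' n, D n + ∑' n, M n := by
    rw [← hSD.tsum_add hSM]
    exact tsum_congr hFDM
  rw [hLD, hA, eq_sub_of_add_eq hsplit.symm, hMsum, hFpsum]
  ring

/-- Absolute convergence passes to a series with some coefficients replaced by `0`. [folklore] -/
theorem lseriesSummable_indicator {a : ℕ → ℂ} {s : ℂ} (hsum : LSeriesSummable a s)
    (P : ℕ → Prop) [DecidablePred P] :
    LSeriesSummable (fun n ↦ if P n then a n else 0) s :=
  Summable.of_norm_bounded hsum.norm fun n => norm_term_le s (by split_ifs <;> simp)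

/-- **Removing finitely many Euler factors** (Kato, Astérisque 295, §6.2, p. 161:
`L_S(f, χ, s) = ∑_{(n,S)=1} aₙ χ(n) n⁻ˢ`; Shimura 1971, Thm. 3.66). If `a : ℕ → ℂ` satisfies
Hecke's relation `a (p n) = a_p a n − e_p 𝟙_{p∣n} a (n/p)` at every prime `p` of a finite set `S`
of primes, then on the domain of absolute convergence
`∑_{(n,S)=1} aₙ n⁻ˢ = ∏_{p ∈ S} (1 − a_p p⁻ˢ + e_p p⁻²ˢ) · ∑ aₙ n⁻ˢ`
(induction on `S` with `LSeries_indicator_not_dvd_eq`; the relation at `p` passes to the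
coefficients already deprived of the primes of `S ∌ p`). [cite: Kato2004Asterisque, §6.2 (p. 161)] -/
theorem LSeries_indicator_coprime_eq {a : ℕ → ℂ} {ap e : ℕ → ℂ} (S : Finset ℕ)
    (hS : ∀ p ∈ S, p.Prime)
    (hrel : ∀ p ∈ S, ∀ n, a (p * n) = ap p * a n - e p * (if p ∣ n then a (n / p) else 0))
    {s : ℂ} (hsum : LSeriesSummable a s) :
    LSeries (fun n ↦ if ∀ p ∈ S, ¬ p ∣ n then a n else 0) s =
      (∏ p ∈ S, (1 - ap p * (p : ℂ) ^ (-s) + e p * ((p : ℂ) ^ (-s)) ^ 2)) * LSeries a s := by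
  classical
  induction S using Finset.induction_on with
  | empty => simp
  | insert q S hq ih =>
    have hqP : q.Prime := hS q (Finset.mem_insert_self q S)
    have hS' : ∀ p ∈ S, p.Prime := fun p hp => hS p (Finset.mem_insert_of_mem hp)
    have hrel' : ∀ p ∈ S, ∀ n, a (p * n) = ap p * a n - e p * (if p ∣ n then a (n / p) else 0) :=
      fun p hp => hrel p (Finset.mem_insert_of_mem hp)
    set aS : ℕ → ℂ := fun n ↦ if ∀ p ∈ S, ¬ p ∣ n then a n else 0 with haS
    -- coprimality to `S` is insensitive to the prime `q ∉ S`
    have hiff : ∀ n, (∀ p ∈ S, ¬ p ∣ q * n) ↔ (∀ p ∈ S, ¬ p ∣ n) := fun n => by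
      refine forall₂_congr fun p hp => not_congr ?_
      have hpq : ¬ p ∣ q := fun h =>
        hq ((Nat.prime_dvd_prime_iff_eq (hS' p hp) hqP).mp h ▸ hp)
      exact ⟨fun h => ((hS' p hp).dvd_mul.mp h).resolve_left hpq, fun h => h.mul_left q⟩
    -- Hecke's relation at `q` for the deprived coefficients
    have hqn_rel := hrel q (Finset.mem_insert_self q S)
    have hpq : ∀ p ∈ S, ¬ p ∣ q := fun p hp h' =>
      hq ((Nat.prime_dvd_prime_iff_eq (hS' p hp) hqP).mp h' ▸ hp)
    have hrelS : ∀ n, aS (q * n) = ap q * aS n - e q * (if q ∣ n then aS (n / q) else 0) := by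
      intro n
      by_cases hn : ∀ p ∈ S, ¬ p ∣ n
      · have h1 : aS (q * n) = a (q * n) := by
          simp only [haS]; exact if_pos ((hiff n).mpr hn)
        have h2 : aS n = a n := by simp only [haS]; exact if_pos hn
        by_cases hqn : q ∣ n
        · have h3 : aS (n / q) = a (n / q) := by
            simp only [haS]
            exact if_pos fun p hp h => hn p hp (h.trans (Nat.div_dvd_of_dvd hqn))
          rw [h1, h2, if_pos hqn, h3, hqn_rel n, if_pos hqn]
        · rw [h1, h2, if_neg hqn, hqn_rel n, if_neg hqn]
      · have h1 : aS (q * n) = 0 := by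
          simp only [haS]; exact if_neg fun h => hn ((hiff n).mp h)
        have h2 : aS n = 0 := by simp only [haS]; exact if_neg hn
        by_cases hqn : q ∣ n
        · have h3 : aS (n / q) = 0 := by
            simp only [haS]
            refine if_neg fun h => hn fun p hp hpn => ?_
            have : p ∣ q * (n / q) := by rwa [Nat.mul_div_cancel' hqn]
            exact h p hp (((hS' p hp).dvd_mul.mp this).resolve_left (hpq p hp))
          rw [h1, h2, if_pos hqn, h3]; ring
        · rw [h1, h2, if_neg hqn]; ring
    have hsumS : LSeriesSummable aS s := lseriesSummable_indicator hsum fun n => ∀ p ∈ S, ¬ p ∣ n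
    have hfun : (fun n ↦ if ∀ p ∈ insert q S, ¬ p ∣ n then a n else 0) =
        fun n ↦ if q ∣ n then 0 else aS n := by
      funext n
      simp only [Finset.forall_mem_insert, haS]
      by_cases hqn : q ∣ n
      · simp [hqn]
      · simp [hqn]
    rw [hfun, LSeries_indicator_not_dvd_eq hqP.one_lt hrelS hsumS, ih hS' hrel',
      Finset.prod_insert hq]
    ring

end EulerFactors

/-! ## 4. The trivial twist of `L(f, s)` and `L(E, s)` -/

section TrivialTwist

open LSeries ModularForms

variable {N : ℕ} [NeZero N]

/-- `n` is prime to `m ≠ 0` iff no prime factor of `m` divides `n`. [folklore] -/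
theorem coprime_iff_forall_primeFactors_not_dvd {m : ℕ} (hm : m ≠ 0) (n : ℕ) :
    n.Coprime m ↔ ∀ p ∈ m.primeFactors, ¬ p ∣ n := by
  constructor
  · intro h p hp hpn
    have hp' := Nat.mem_primeFactors.mp hp
    have h1 : p ∣ Nat.gcd n m := Nat.dvd_gcd hpn hp'.2.1
    rw [h.gcd_eq_one, Nat.dvd_one] at h1
    exact hp'.1.one_lt.ne' h1
  · intro h
    exact Nat.coprime_of_dvd fun k hk hkn hkm => h k (Nat.mem_primeFactors.mpr ⟨hk, hkm, hm⟩) hkn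

/-- The trivial Dirichlet character mod `m` is the indicator of the integers prime to `m`, i.e.
of those divisible by no prime factor of `m` (Mathlib `MulChar.one_apply`,
`ZMod.isUnit_iff_coprime`). [folklore] -/
theorem dirichletCharacter_one_apply_natCast {m : ℕ} [NeZero m] (n : ℕ) :
    (1 : DirichletCharacter ℂ m) (n : ZMod m) =
      if ∀ p ∈ m.primeFactors, ¬ p ∣ n then 1 else 0 := by
  by_cases hu : IsUnit (n : ZMod m)
  · rw [MulChar.one_apply hu, if_pos]
    exact (coprime_iff_forall_primeFactors_not_dvd (NeZero.ne m) n).mp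
      ((ZMod.isUnit_iff_coprime n m).mp hu)
  · rw [MulChar.map_nonunit _ hu, if_neg]
    exact fun h => hu ((ZMod.isUnit_iff_coprime n m).mpr
      ((coprime_iff_forall_primeFactors_not_dvd (NeZero.ne m) n).mpr h))

/-- Hecke's relation at a prime `p` in weight `2`: `a_{pn} = a_p aₙ − 𝟙_N(p) p 𝟙_{p∣n} a_{n/p}`
for a newform `f ∈ S₂(Γ₀(N))` (Diamond–Shurman Prop. 5.8.5; the tree's
`IsNewform0.cuspCoeff_prime_mul` with `p^{k-1} = p`). [cite: DiamondShurman2005, Prop. 5.8.5] -/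
theorem ModularForms.IsNewform0.cuspCoeff_prime_mul_weight_two {f : CuspForm (Gamma0 N) 2}
    (hf : IsNewform0 f) {p : ℕ} (hp : p.Prime) (n : ℕ) :
    cuspCoeff f (p * n) = cuspCoeff f p * cuspCoeff f n -
      (if p ∣ N then 0 else (p : ℂ)) * (if p ∣ n then cuspCoeff f (n / p) else 0) := by
  have h := hf.cuspCoeff_prime_mul hp n
  rw [show (2 : ℤ) - 1 = 1 by norm_num, zpow_one] at h
  rw [h]
  split_ifs <;> ring

/-- **`L_{prime(m)}(f, 𝟙, s) = ∏_{p ∣ m} (1 − a_p p⁻ˢ + 𝟙_N(p) p · p⁻²ˢ) · L(f, s)`** for a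
newform `f ∈ S₂(Γ₀(N))`, the trivial character mod `m` and `re s > 2` (Kato, Astérisque 295,
§6.2, p. 161, and the remark after Thm. 14.2, p. 235: `L(f, χ, s)` means `L_S(f, χ, s)`,
`S = prime(m)`; Shimura 1971, Thm. 3.66). [cite: Kato2004Asterisque, §6.2 (p. 161)] -/
theorem twistedLSeries_one_eq {f : CuspForm (Gamma0 N) 2} (hf : IsNewform0 f) (m : ℕ) [NeZero m]
    {s : ℂ} (hs : 2 < s.re) :
    twistedLSeries f (1 : DirichletCharacter ℂ m) s =
      (∏ p ∈ m.primeFactors, (1 - cuspCoeff f p * (p : ℂ) ^ (-s) +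
        (if p ∣ N then 0 else (p : ℂ)) * ((p : ℂ) ^ (-s)) ^ 2)) * cuspFormLSeries f s := by
  have hfun : (fun n : ℕ ↦ (1 : DirichletCharacter ℂ m) n * cuspCoeff f n) =
      fun n ↦ if ∀ p ∈ m.primeFactors, ¬ p ∣ n then cuspCoeff f n else 0 := by
    funext n
    rw [dirichletCharacter_one_apply_natCast]
    split_ifs <;> simp
  rw [twistedLSeries, hfun, cuspFormLSeries]
  exact LSeries_indicator_coprime_eq m.primeFactors (fun p hp => Nat.prime_of_mem_primeFactors hp)
    (fun p hp n => hf.cuspCoeff_prime_mul_weight_two (Nat.prime_of_mem_primeFactors hp) n)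
    (LSeriesSummable_cuspCoeff_gamma0 f (by push_cast; linarith))

omit [NeZero N] in
/-- For `m = 1` nothing is removed: `L(f, 𝟙 mod 1, s) = L(f, s)` (every residue mod `1` is a
unit). [folklore] -/
theorem twistedLSeries_one_eq_cuspFormLSeries_of_one (f : CuspForm (Gamma0 N) 2) (s : ℂ) :
    twistedLSeries f (1 : DirichletCharacter ℂ 1) s = cuspFormLSeries f s := by
  rw [twistedLSeries, cuspFormLSeries]
  congr 1
  funext n
  rw [MulChar.one_apply (isUnit_of_subsingleton _), one_mul]

/-- **`L_{prime(m)}(f, 𝟙, 1) ≠ 0 ⇒ L(E, 1) ≠ 0`.** Let `f` be the newform of the elliptic curve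
`W/ℚ` (`IsNewformOf W f`, so `L(W, s) = L(f, s)` is entire, continued by `W.entireLFunction`). If
an entire continuation `L` of the mod-`m` trivial twist `L_{prime(m)}(f, 𝟙, s) = ∑_{(n,m)=1} aₙ n⁻ˢ`
(`re s > 2`) has `L(1) ≠ 0`, then `L(E, 1) ≠ 0`: by `twistedLSeries_one_eq` and the identity
theorem `L = ∏_{p ∣ m} (1 − a_p p⁻ˢ + 𝟙_N(p) p^{1-2s}) · L(E, ·)` on all of `ℂ` (the Euler
polynomials are entire), and a non-zero product has non-zero factors. (Kato, Astérisque 295,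
p. 235: "`L(f, χ, s)` means `L_S(f, χ, s)`".) [cite: Kato2004Asterisque, §14 Thm. 14.2 (p. 235)] -/
theorem entireLFunction_one_ne_zero_of_twistedLSeries_one {W : WeierstrassCurve ℚ}
    {f : CuspForm (Gamma0 N) 2} (hf : IsNewformOf W f) {m : ℕ} [NeZero m]
    (hL : ∃ L : ℂ → ℂ, Differentiable ℂ L ∧
      (∀ s : ℂ, 2 < s.re → L s = twistedLSeries f (1 : DirichletCharacter ℂ m) s) ∧ L 1 ≠ 0) :
    W.entireLFunction 1 ≠ 0 := by
  obtain ⟨L, hLd, hLs, hL1⟩ := hL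
  have hE : W.HasEntireLFunction :=
    W.hasEntireLFunction_of_cuspCoeff_eq (strictWidthInfty_Gamma0 N) f hf.2
  set P : ℂ → ℂ := fun s ↦ ∏ p ∈ m.primeFactors, (1 - cuspCoeff f p * (p : ℂ) ^ (-s) +
    (if p ∣ N then 0 else (p : ℂ)) * ((p : ℂ) ^ (-s)) ^ 2) with hP
  have ht : ∀ p ∈ m.primeFactors, Differentiable ℂ fun s : ℂ => (p : ℂ) ^ (-s) := fun p hp =>
    differentiable_neg.const_cpow
      (Or.inl (Nat.cast_ne_zero.mpr (Nat.prime_of_mem_primeFactors hp).ne_zero))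
  have hPd : Differentiable ℂ P := by
    rw [hP]
    exact Differentiable.fun_finsetProd (𝕜 := ℂ) (u := m.primeFactors)
      (f := fun (p : ℕ) (s : ℂ) => 1 - cuspCoeff f p * (p : ℂ) ^ (-s) +
        (if p ∣ N then 0 else (p : ℂ)) * ((p : ℂ) ^ (-s)) ^ 2)
      fun p hp => ((differentiable_const _).sub ((differentiable_const _).mul (ht p hp))).add
        ((differentiable_const _).mul ((ht p hp).pow 2))
  have hLP : L = fun s => P s * W.entireLFunction s := by
    refine AnalyticOnNhd.eq_of_eventuallyEq (z₀ := (3 : ℂ))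
      (hLd.differentiableOn.analyticOnNhd isOpen_univ)
      ((hPd.mul (W.differentiable_entireLFunction hE)).differentiableOn.analyticOnNhd
        isOpen_univ) ?_
    have hopen : IsOpen {s : ℂ | 2 < s.re} := isOpen_lt continuous_const continuous_re
    have hmem : (3 : ℂ) ∈ {s : ℂ | 2 < s.re} := by simp; norm_num
    filter_upwards [hopen.mem_nhds hmem] with s hs
    have hs' : (3 / 2 : ℝ) < s.re := by
      have : (2 : ℝ) < s.re := hs
      linarith
    rw [hLs s hs, twistedLSeries_one_eq hf.1 m hs, hf.cuspFormLSeries_eq,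
      W.entireLFunction_eq_LSeries hE hs']
  intro h0
  apply hL1
  rw [hLP]
  simp [h0]

/-- Conversely, for `m = 1`: `L(E, 1) ≠ 0` produces the hypothesis of Kato's corollary at the
trivial character mod `1`, with `L = W.entireLFunction` itself
(`twistedLSeries_one_eq_cuspFormLSeries_of_one`). [folklore] -/
theorem exists_continuation_twistedLSeries_one_of_entireLFunction_one_ne_zero
    {W : WeierstrassCurve ℚ} {f : CuspForm (Gamma0 N) 2} (hf : IsNewformOf W f)
    (h1 : W.entireLFunction 1 ≠ 0) :
    ∃ L : ℂ → ℂ, Differentiable ℂ L ∧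
      (∀ s : ℂ, 2 < s.re → L s = twistedLSeries f (1 : DirichletCharacter ℂ 1) s) ∧ L 1 ≠ 0 := by
  have hE : W.HasEntireLFunction :=
    W.hasEntireLFunction_of_cuspCoeff_eq (strictWidthInfty_Gamma0 N) f hf.2
  refine ⟨W.entireLFunction, W.differentiable_entireLFunction hE, fun s hs => ?_, h1⟩
  have hs' : (3 / 2 : ℝ) < s.re := by
    have : (2 : ℝ) < s.re := hs
    linarith
  rw [twistedLSeries_one_eq_cuspFormLSeries_of_one, hf.cuspFormLSeries_eq,
    W.entireLFunction_eq_LSeries hE hs']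

end TrivialTwist

/-! ## 5. Assembly -/

section Assembly

open ModularForms

variable {m : ℕ} [NeZero m]

/-- The character of `Gal(ℚ(ζ_m)/ℚ)` attached to the trivial Dirichlet character mod `m` is
trivial. [folklore] -/
theorem cyclotomicCharacterOf_one_apply (σ : CyclotomicField m ℚ ≃ₐ[ℚ] CyclotomicField m ℚ) :
    (cyclotomicCharacterOf (1 : DirichletCharacter ℂ m) σ : ℂ) = 1 := by
  rw [coe_cyclotomicCharacterOf_apply]
  exact MulChar.one_apply_coe _

set_option backward.isDefEq.respectTransparency false in
/-- **bsd.S20 ⇒ Kato's Cor. 14.3 (2) over `ℚ(ζ_m)` at the trivial character, every `m ≥ 1`.**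
Assume `kato_finite_of_L_one_ne_zero W p` for every elliptic `W/ℚ` and prime `p` (Kato,
Astérisque 295, Cor. 14.3 for `K = ℚ`, `χ = 1`: `L(E, 1) ≠ 0 ⇒ E(ℚ)` finite, …). Then for
`E = W/ℚ` elliptic with newform `f`, `K = ℚ(ζ_m)` and the trivial character `𝟙` mod `m`: if an
entire continuation of `L_{prime(m)}(f, 𝟙, s)` does not vanish at `s = 1`, the `χ`-part
`E(K)^(𝟙)` is finite — the instance `χ = 1` of the all-moduli form (the statement of
`kato_finite_chiPart_cyclotomic_of_twistedLValue_ne_zero_of`; any decidability instance on `K`).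
Proof: `L_{prime(m)}(f, 𝟙, 1) ≠ 0 ⇒ L(E, 1) ≠ 0`
(`entireLFunction_one_ne_zero_of_twistedLSeries_one`) `⇒ E(ℚ)` finite (bsd.S20 at `p = 2`)
`⇒ E(K)^(𝟙) = ι(E(ℚ))` finite (`finite_chiPart_one_iff`, `ℚ(ζ_m)/ℚ` being Galois).
[cite: Kato2004Asterisque, Cor. 14.3 (2) (p. 235)] -/
theorem kato_finite_chiPart_cyclotomic_one_of_kato_finite_of_L_one_ne_zero
    (hK : ∀ (W : WeierstrassCurve ℚ) [W.IsElliptic] (p : ℕ) [Fact p.Prime],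
      kato_finite_of_L_one_ne_zero W p)
    (W : WeierstrassCurve ℚ) [W.IsElliptic] {N : ℕ} [NeZero N] {f : CuspForm (Gamma0 N) 2}
    (hf : IsNewformOf W f) [DecidableEq (CyclotomicField m ℚ)]
    (hL : ∃ L : ℂ → ℂ, Differentiable ℂ L ∧
      (∀ s : ℂ, 2 < s.re → L s = twistedLSeries f (1 : DirichletCharacter ℂ m) s) ∧ L 1 ≠ 0) :
    Finite ↥(chiPart
      (fun σ : CyclotomicField m ℚ ≃ₐ[ℚ] CyclotomicField m ℚ =>
        Point.map (W' := W.toAffine) (σ : CyclotomicField m ℚ →ₐ[ℚ] CyclotomicField m ℚ))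
      (fun σ => (cyclotomicCharacterOf (1 : DirichletCharacter ℂ m) σ : ℂ))) := by
  haveI : Fact (Nat.Prime 2) := ⟨Nat.prime_two⟩
  haveI := IsCyclotomicExtension.isGalois {m} ℚ (CyclotomicField m ℚ)
  haveI : Finite W.toAffine.Point :=
    (hK W 2 (entireLFunction_one_ne_zero_of_twistedLSeries_one hf hL)).1
  exact (finite_chiPart_one_iff W cyclotomicCharacterOf_one_apply).mpr ‹_›

set_option backward.isDefEq.respectTransparency false in
/-- **Kato's Cor. 14.3 (2) over `ℚ(ζ_1)` gives the Mordell–Weil clause of bsd.S20.** Assume the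
vendored fact `kato_finite_chiPart_of_twistedLValue_ne_zero` (Kato, Astérisque 295, Cor. 14.3
(2), `K = ℚ(ζ_m)`, `m ≢ 2 (mod 4)`). Then for every elliptic `E = W/ℚ` with a newform `f`:
`L(E, 1) ≠ 0 ⇒ E(ℚ)` is finite (the first clause of `kato_finite_of_L_one_ne_zero W p`; Kato,
Cor. 14.3 (2) with `K = ℚ`, `χ = 1`; Kolyvagin 1988). Proof: take `m = 1`, `χ = 𝟙`, the
continuation `L = L(E, ·)` (`exists_continuation_twistedLSeries_one_of_entireLFunction_one_ne_zero`),
and descend `E(ℚ(ζ_1))^(𝟙) = ι(E(ℚ))` (`finite_chiPart_one_iff`).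
[cite: Kato2004Asterisque, Cor. 14.3 (2) (p. 235)] -/
theorem finite_point_of_kato_finite_chiPart (hK : kato_finite_chiPart_of_twistedLValue_ne_zero)
    (W : WeierstrassCurve ℚ) [W.IsElliptic] {N : ℕ} [NeZero N] {f : CuspForm (Gamma0 N) 2}
    (hf : IsNewformOf W f) (h1 : W.entireLFunction 1 ≠ 0) : Finite W.toAffine.Point := by
  classical
  haveI := IsCyclotomicExtension.isGalois {1} ℚ (CyclotomicField 1 ℚ)
  have hfin := hK W hf (m := 1) (by decide) 1
    (exists_continuation_twistedLSeries_one_of_entireLFunction_one_ne_zero hf h1)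
  exact (finite_chiPart_one_iff W cyclotomicCharacterOf_one_apply).mp hfin

set_option backward.isDefEq.respectTransparency false in
/-- The same from the all-moduli form of the vendored fact (every `m ≥ 1`, any decidability
instance on `ℚ(ζ_m)`; the statement of `kato_finite_chiPart_cyclotomic_of_twistedLValue_ne_zero_of`,
equivalent to the vendored fact by `kato_finite_chiPart_cyclotomic_iff` of
`KatoTwistedFinitenessProofs`; written out as the hypothesis `hK`, here used directly at `m = 1`).
[cite: Kato2004Asterisque, Cor. 14.3 (2) (p. 235)] -/
theorem finite_point_of_kato_finite_chiPart_cyclotomic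
    (hK : ∀ (W : WeierstrassCurve ℚ) [W.IsElliptic] {N : ℕ} [NeZero N] {f : CuspForm (Gamma0 N) 2}
      (_hf : IsNewformOf W f) {m : ℕ} [NeZero m] [DecidableEq (CyclotomicField m ℚ)]
      (χ : DirichletCharacter ℂ m)
      (_hL : ∃ L : ℂ → ℂ, Differentiable ℂ L ∧
        (∀ s : ℂ, 2 < s.re → L s = twistedLSeries f χ s) ∧ L 1 ≠ 0),
      Finite (chiPart
        (fun σ : CyclotomicField m ℚ ≃ₐ[ℚ] CyclotomicField m ℚ =>
          Point.map (W' := W.toAffine) (σ : CyclotomicField m ℚ →ₐ[ℚ] CyclotomicField m ℚ))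
        (fun σ => (cyclotomicCharacterOf χ σ : ℂ))))
    (W : WeierstrassCurve ℚ) [W.IsElliptic] {N : ℕ} [NeZero N] {f : CuspForm (Gamma0 N) 2}
    (hf : IsNewformOf W f) (h1 : W.entireLFunction 1 ≠ 0) : Finite W.toAffine.Point := by
  classical
  haveI := IsCyclotomicExtension.isGalois {1} ℚ (CyclotomicField 1 ℚ)
  have hfin := hK W hf (m := 1) 1
    (exists_continuation_twistedLSeries_one_of_entireLFunction_one_ne_zero hf h1)
  exact (finite_chiPart_one_iff W cyclotomicCharacterOf_one_apply).mp hfin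

end Assembly

end Literature.NumberTheory.EllipticCurves

end
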